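import Summits.CriticalPhenomena.PercolationContinuityZ3.Theorems.PercNearOneGluingNoHeavyPcintNawFreeMemKernelSites
import HarnessLib

/-!
# PCINT lane, reduction B2d on the dangerous-set automaton — the kernel certificate theorem

Cell `prim-pcint` (PAPER-2 track (iii)), seat `prim-pcint-1` (gen 6); support file (`--supports stmt-CriticalPhenomena-4575`).
Does NOT build on p205010.  Memo: run/shared/lean/prim/pcint/REDUCTIONS.md §B2d.

The weight family is a table of numerators `QL = [Q_0, …, Q_{2d}]` over a common denominator `D` (`qv k = Q_k / D`, and `1` beyond
the table).  Row check `NawK.checkRowF τ kt d N pn D QL lamN lamD syms t i` (table format `NawK.NT`, match test `NawK.termOK` as for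
the B2r/B2c certificates; integer term `pn · U · F · V_j` with `U = ∏_{inspected w} (Q_{cnt}^{npay} D^{2-npay} | D²) · D^{2(2d-ℓ)}`
over `D^{4d}` and `F = D^{4d} + C | 2 D^{4d}` over `2 D^{4d}`; inequality `lamD · Σ ≤ lamN · 2 · D^{8d+1} · V`) and
**`NawK.le_siteCriticalProb_of_checkRowsF`**: all rows pass + row 0 empty + valid symmetry tables + `QL` admissible (`Q_k ≤ D`,
nondecreasing, `(D-pn) D^{k-1} ≤ Q_k^k` for `1 ≤ k ≤ 2d`) + `lamN < lamD` ⇒ `pn / D ≤ p_c^site(ℤ^d)`.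
-/

namespace Summit.CriticalPhenomena.PercolationContinuityZ3.Theorems.Pcint

open Finset Literature.Probability.Percolation Literature.Probability.LatticeModels

namespace NawK

open WinK (toSite toL addL adjL toSite_addL toSite_toL adj_iff_adjL toSite_inj length_toL length_addL)

variable {d : ℕ}

section CheckF

variable (τ kt d N pn D lamN lamD : ℕ) (QL : List ℕ) (syms : List (List (ℕ × Bool))) (t : NT)

/-- The numerator of the weight family: `Q_k` from the table, `D` beyond it. [folklore] -/
def Qn (k : ℕ) : ℕ := QL.getD k D

/-- Site numerator over `D²`: `Q_{cnt}^{npay} · D^{2-npay}`. [folklore] -/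
def siteNumK (K : KState) (w : List ℤ) : ℕ :=
  Qn D QL (fcntK τ d K w) ^ fnpayK τ kt d K w * D ^ (2 - fnpayK τ kt d K w)

/-- Unconditional numerator over `D^{4d}`. [folklore] -/
def uNumK (K : KState) : ℕ :=
  ((fsitesK kt d K).map fun w => if funcondK d K w then siteNumK τ kt d D QL K w else D ^ 2).prod *
    D ^ (2 * (2 * d - (fsitesK kt d K).length))

/-- Conditional numerator over `D^{4d}`. [folklore] -/
def cNumK (K : KState) : ℕ :=
  ((fsitesK kt d K).map fun w => if fcondK kt d K w then siteNumK τ kt d D QL K w else D ^ 2).prod *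
    D ^ (2 * (2 * d - (fsitesK kt d K).length))

/-- Kernel `fhasC`. [folklore] -/
def hasCK (K : KState) : Bool := (fsitesK kt d K).any fun w => fcondK kt d K w && !(fnpayK τ kt d K w == 0)

/-- Integer value of one letter: `pn · U · F · V_j`, `F = D^{4d} + C` if the step has a conditional payment, else `2 D^{4d}`.
[folklore] -/
def termValF (L : KState) (a : Fin d × Bool) (os : Option (ℕ × ℕ)) : ℕ :=
  match os with
  | none => 0
  | some jc =>
    pn * uNumK τ kt d D QL (fKK d L a) *
      (if hasCK τ kt d (fKK d L a) then D ^ (4 * d) + cNumK τ kt d D QL (fKK d L a) else 2 * D ^ (4 * d)) * vOf t jc.1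

/-- Integer row sum. [folklore] -/
def rowValF (L : KState) (sc : ℕ → Option (ℕ × ℕ)) : ℕ :=
  ((letters d).map fun a => termValF τ kt d pn D QL t L a (sc (letterIdx a))).sum

/-- **Row check**: well-formed state with valid ages, `V ≥ 1`, matching successors, and
`lamD · Σ ≤ lamN · 2 · D^{8d+1} · V`. [folklore] -/
def checkRowF (i : ℕ) : Bool :=
  match t.find i with
  | none => false
  | some v =>
    WF d v.2.1 && AOK v.2.1 && decide (1 ≤ v.1) &&
      (letters d).all (fun a => termOK τ d N syms t v.2.1 a (v.2.2.getD (letterIdx a) none)) &&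
      decide (lamD * rowValF τ kt d pn D QL t v.2.1 (fun k => v.2.2.getD k none) ≤ lamN * 2 * D ^ (8 * d + 1) * v.1)

/-- **Admissible weight table**: `Q_k ≤ D`, nondecreasing, and `(D - pn) · D^{k-1} ≤ Q_k^k` for `1 ≤ k ≤ 2d`. [folklore] -/
def QLok : Bool :=
  QL.all (fun q => decide (q ≤ D)) &&
    (List.range QL.length).all (fun k => decide (Qn D QL k ≤ Qn D QL (k + 1))) &&
    (List.range (2 * d + 1)).all (fun k => decide (k = 0 ∨ (D - pn) * D ^ (k - 1) ≤ Qn D QL k ^ k))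

end CheckF

section SoundF

variable {τ kt d N pn D lamN lamD : ℕ} {QL : List ℕ} {syms : List (List (ℕ × Bool))} {t : NT}

/-- What a passed row check says. [folklore] -/
theorem checkRowF_spec {i : ℕ} (h : checkRowF τ kt d N pn D lamN lamD QL syms t i = true) :
    ∃ v, t.find i = some v ∧ WF d v.2.1 = true ∧ AOK v.2.1 = true ∧ 1 ≤ v.1 ∧
      (∀ a, termOK τ d N syms t v.2.1 a (v.2.2.getD (letterIdx a) none) = true) ∧
      lamD * rowValF τ kt d pn D QL t v.2.1 (fun k => v.2.2.getD k none) ≤ lamN * 2 * D ^ (8 * d + 1) * v.1 := by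
  unfold checkRowF at h
  cases hf : t.find i with
  | none => rw [hf] at h; exact Bool.noConfusion h
  | some v =>
    rw [hf] at h
    simp only [Bool.and_eq_true, decide_eq_true_eq, List.all_eq_true] at h
    obtain ⟨⟨⟨⟨hwf, hA⟩, hv⟩, hall⟩, hineq⟩ := h
    exact ⟨v, rfl, hwf, hA, hv, fun a => hall a (mem_letters a), hineq⟩

/-- `Qn` beyond the table. [folklore] -/
theorem Qn_of_le {k : ℕ} (hk : QL.length ≤ k) : Qn D QL k = D := by
  rw [Qn, List.getD_eq_getElem?_getD, List.getElem?_eq_none_iff.2 hk, Option.getD_none]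

/-- What an admissible table gives: the hypotheses of the soundness theorem for `qv k = Q_k / D`. [folklore] -/
theorem QLok_spec (hQ : QLok d pn D QL = true) (hD : 0 < D) (hpn : pn ≤ D) :
    (∀ k, Qn D QL k ≤ D) ∧ (∀ k k', k ≤ k' → Qn D QL k ≤ Qn D QL k') ∧
      ∀ k, k ≤ 2 * d → 1 - (pn : ℝ) / D ≤ ((Qn D QL k : ℝ) / D) ^ k := by
  unfold QLok at hQ
  simp only [Bool.and_eq_true, List.all_eq_true, decide_eq_true_eq, List.mem_range] at hQ
  obtain ⟨⟨h1, h2⟩, h3⟩ := hQ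
  have hle : ∀ k, Qn D QL k ≤ D := by
    intro k
    by_cases hk : k < QL.length
    · rw [Qn, List.getD_eq_getElem?_getD, List.getElem?_eq_getElem hk, Option.getD_some]
      exact h1 _ (List.getElem_mem hk)
    · rw [Qn_of_le (by omega)]
  have hstep : ∀ k, Qn D QL k ≤ Qn D QL (k + 1) := by
    intro k
    by_cases hk : k < QL.length
    · exact h2 k hk
    · rw [Qn_of_le (by omega), Qn_of_le (by omega)]
  have hmono : ∀ k k', k ≤ k' → Qn D QL k ≤ Qn D QL k' := by
    intro k k' hkk
    induction hkk with
    | refl => exact le_rfl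
    | step _ ih => exact ih.trans (hstep _)
  refine ⟨hle, hmono, fun k hk => ?_⟩
  have hDr : (0 : ℝ) < D := Nat.cast_pos.2 hD
  rcases Nat.eq_zero_or_pos k with rfl | hk0
  · rw [pow_zero, sub_le_self_iff]; positivity
  · have h3k := h3 k (by omega)
    rcases h3k with h | h
    · omega
    · have key : ((D : ℝ) - pn) * (D : ℝ) ^ (k - 1) ≤ (Qn D QL k : ℝ) ^ k := by
        have e1 : (((D - pn : ℕ) : ℝ)) = (D : ℝ) - pn := Nat.cast_sub hpn
        rw [← e1]; exact_mod_cast h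
      have e2 : 1 - (pn : ℝ) / D = ((D : ℝ) - pn) / D := by field_simp
      rw [e2, div_pow, div_le_div_iff₀ hDr (pow_pos hDr _)]
      have e3 : (D : ℝ) ^ k = (D : ℝ) ^ (k - 1) * D := by rw [← pow_succ]; congr 1; omega
      calc ((D : ℝ) - pn) * (D : ℝ) ^ k = ((D : ℝ) - pn) * (D : ℝ) ^ (k - 1) * D := by rw [e3]; ring
        _ ≤ (Qn D QL k : ℝ) ^ k * D := mul_le_mul_of_nonneg_right key hDr.le

/-- `fnpayK ≤ 2`. [folklore] -/
theorem fnpayK_le_two (K : KState) (w : List ℤ) : fnpayK τ kt d K w ≤ 2 := by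
  unfold fnpayK; split_ifs <;> omega

/-- The kernel inspected sites are at most `2d`. [folklore] -/
theorem length_fsitesK_le (K : KState) : (fsitesK kt d K).length ≤ 2 * d := by
  unfold fsitesK
  cases posAtK K kt with
  | none => simp
  | some P =>
    simp only
    refine (List.length_filter_le _ _).trans ?_
    rw [nbrL, List.length_map, length_letters]

/-- The real value of a site numerator: `siteNum / D² = (Q_{cnt}/D)^{npay}`. [folklore] -/
theorem siteNumK_real (hD : (0 : ℝ) < D) (K : KState) (w : List ℤ) :
    (siteNumK τ kt d D QL K w : ℝ) / (D : ℝ) ^ 2 = ((Qn D QL (fcntK τ d K w) : ℝ) / D) ^ fnpayK τ kt d K w := by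
  have hn := fnpayK_le_two (τ := τ) (kt := kt) (d := d) K w
  rw [siteNumK, div_pow]
  push_cast
  have e1 : (D : ℝ) ^ 2 = (D : ℝ) ^ fnpayK τ kt d K w * (D : ℝ) ^ (2 - fnpayK τ kt d K w) := by
    rw [← pow_add]; congr 1; omega
  rw [e1]
  field_simp

/-- `∏ l / D^{2|l|} = ∏ (x / D²)`. [folklore] -/
theorem prod_div_pow_real (l : List ℕ) :
    ((l.prod : ℕ) : ℝ) / (D : ℝ) ^ (2 * l.length) = (l.map fun x : ℕ => (x : ℝ) / (D : ℝ) ^ 2).prod := by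
  induction l with
  | nil => simp
  | cons y ys ih =>
    simp only [List.prod_cons, List.length_cons, List.map_cons, Nat.cast_mul]
    rw [show 2 * (ys.length + 1) = 2 + 2 * ys.length by ring, pow_add, mul_div_mul_comm, ih]

/-- A product of factors over `D²` each, padded to `M` factors: its real value. [folklore] -/
theorem prod_pad_real (hD : (0 : ℝ) < D) (l : List ℕ) (n M : ℕ) (hn : l.length = n) (hM : n ≤ M) :
    ((l.prod * D ^ (2 * (M - n)) : ℕ) : ℝ) / (D : ℝ) ^ (2 * M) = (l.map fun x : ℕ => (x : ℝ) / (D : ℝ) ^ 2).prod := by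
  rw [← prod_div_pow_real, hn, Nat.cast_mul, Nat.cast_pow, show 2 * M = 2 * n + 2 * (M - n) by omega, pow_add,
    mul_div_mul_comm, div_self (pow_ne_zero _ hD.ne'), mul_one]

/-- The real value of an integer term. [folklore] -/
theorem termValF_real_eq {U F Vj : ℕ} (hD : (0 : ℝ) < D) :
    ((pn * U * F * Vj : ℕ) : ℝ) / (2 * (D : ℝ) ^ (8 * d + 1)) =
      (pn : ℝ) / D * ((U : ℝ) / (D : ℝ) ^ (4 * d)) * ((F : ℝ) / (2 * (D : ℝ) ^ (4 * d))) * Vj := by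
  have hsplit : (D : ℝ) ^ (8 * d + 1) = (D : ℝ) ^ (4 * d) * (D : ℝ) ^ (4 * d) * D := by
    rw [← pow_add, ← pow_succ]; congr 1; omega
  rw [hsplit]
  push_cast
  field_simp

/-- The unconditional numerator computes `fU`. [folklore] -/
theorem uNumK_real_eq (hD : (0 : ℝ) < D) {L : KState} (hL : WF d L = true) (hA : AOK L = true) (a : Fin d × Bool) :
    (uNumK τ kt d D QL (fKK d L a) : ℝ) / (D : ℝ) ^ (4 * d) =
      fU τ kt (fun k => (Qn D QL k : ℝ) / D) (toM L : MState d) a := by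
  obtain ⟨h1, h2⟩ := fsites_eq_toFinset (kt := kt) (a := a) hL hA
  rw [uNumK, show 4 * d = 2 * (2 * d) by ring,
    prod_pad_real hD _ _ (2 * d) (List.length_map _) (length_fsitesK_le _), fU, h1, List.prod_toFinset _ h2,
    List.map_map, List.map_map]
  refine congrArg List.prod (List.map_congr_left fun w hw => ?_)
  have hwl := length_of_mem_fsitesK hL hw
  simp only [Function.comp_apply]
  rw [funcondK_eq hL hwl]
  split_ifs with hu
  · rw [siteNumK_real hD, fcntK_eq hL hA hwl, fnpayK_eq hL hA hwl]
  · push_cast; rw [div_self (pow_ne_zero _ hD.ne')]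

/-- The conditional numerator computes `fC`. [folklore] -/
theorem cNumK_real_eq (hD : (0 : ℝ) < D) {L : KState} (hL : WF d L = true) (hA : AOK L = true) (a : Fin d × Bool) :
    (cNumK τ kt d D QL (fKK d L a) : ℝ) / (D : ℝ) ^ (4 * d) =
      fC τ kt (fun k => (Qn D QL k : ℝ) / D) (toM L : MState d) a := by
  obtain ⟨h1, h2⟩ := fsites_eq_toFinset (kt := kt) (a := a) hL hA
  rw [cNumK, show 4 * d = 2 * (2 * d) by ring,
    prod_pad_real hD _ _ (2 * d) (List.length_map _) (length_fsitesK_le _), fC, h1, List.prod_toFinset _ h2,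
    List.map_map, List.map_map]
  refine congrArg List.prod (List.map_congr_left fun w hw => ?_)
  have hwl := length_of_mem_fsitesK hL hw
  simp only [Function.comp_apply]
  rw [fcondK_eq hL hA hwl]
  split_ifs with hu
  · rw [siteNumK_real hD, fcntK_eq hL hA hwl, fnpayK_eq hL hA hwl]
  · push_cast; rw [div_self (pow_ne_zero _ hD.ne')]

/-- `hasCK` computes `fhasC`. [folklore] -/
theorem hasCK_eq {L : KState} (hL : WF d L = true) (hA : AOK L = true) (a : Fin d × Bool) :
    hasCK τ kt d (fKK d L a) = fhasC τ kt (toM L : MState d) a := by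
  obtain ⟨h1, h2⟩ := fsites_eq_toFinset (kt := kt) (a := a) hL hA
  rw [Bool.eq_iff_iff, hasCK, List.any_eq_true, fhasC_iff, h1]
  constructor
  · rintro ⟨w, hw, h⟩
    have hwl := length_of_mem_fsitesK hL hw
    simp only [Bool.and_eq_true, Bool.not_eq_true', beq_eq_false_iff_ne, ne_eq] at h
    refine ⟨toSite w, List.mem_toFinset.2 (List.mem_map.2 ⟨w, hw, rfl⟩), ?_, ?_⟩
    · rw [← fcondK_eq hL hA hwl]; exact h.1
    · rw [← fnpayK_eq hL hA hwl]; exact h.2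
  · rintro ⟨W, hW, hc, hp⟩
    obtain ⟨w, hw, rfl⟩ := List.mem_map.1 (List.mem_toFinset.1 hW)
    have hwl := length_of_mem_fsitesK hL hw
    refine ⟨w, hw, ?_⟩
    simp only [Bool.and_eq_true, Bool.not_eq_true', beq_eq_false_iff_ne, ne_eq]
    exact ⟨by rw [fcondK_eq hL hA hwl]; exact hc, by rw [fnpayK_eq hL hA hwl]; exact hp⟩

/-- **Soundness of the B2d kernel certificate.**  If every row `i < N` passes `checkRowF`, row `0` carries the empty state, the
symmetry numbers denote lattice symmetries, the weight table is admissible, `pn ≤ D`, `lamN < lamD`, `2 kt ≤ τ`, `2 ≤ kt`, then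
`pn / D ≤ p_c^site(ℤ^d)`. [folklore] -/
theorem le_siteCriticalProb_of_checkRowsF [NeZero d] (hτ : 2 ≤ τ) (hkt : 2 * kt ≤ τ) (hkt2 : 2 ≤ kt) (sym : ℕ → SPerm d)
    (hsyms : ∀ c < syms.length, syms.getD c [] = spermKL (sym c))
    (hrows : ∀ i < N, checkRowF τ kt d N pn D lamN lamD QL syms t i = true)
    (hN : 0 < N) (h0 : stOf t 0 = []) (hD : 0 < D) (hpn : pn ≤ D) (hQ : QLok d pn D QL = true) (hlam : lamN < lamD) :
    (pn : ℝ) / D ≤ siteCriticalProb (zdGraph d) 0 := by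
  classical
  have hDr : (0 : ℝ) < D := Nat.cast_pos.2 hD
  have hlamDr : (0 : ℝ) < lamD := Nat.cast_pos.2 (by omega)
  obtain ⟨hQle, hQmono, hQpow⟩ := QLok_spec (d := d) hQ hD hpn
  set p : unitInterval := ⟨(pn : ℝ) / D, div_nonneg (Nat.cast_nonneg _) hDr.le,
    div_le_one_of_le₀ (by exact_mod_cast hpn) hDr.le⟩ with hp
  set qv : ℕ → ℝ := fun k => (Qn D QL k : ℝ) / D with hqv
  set lam : ℝ := (lamN : ℝ) / lamD with hlamdef
  have hq0 : ∀ k, 0 ≤ qv k := fun k => div_nonneg (Nat.cast_nonneg _) hDr.le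
  have hq1 : ∀ k, qv k ≤ 1 := fun k => div_le_one_of_le₀ (by exact_mod_cast hQle k) hDr.le
  have hmono : ∀ k k', k ≤ k' → qv k ≤ qv k' := fun k k' h =>
    div_le_div_of_nonneg_right (by exact_mod_cast hQmono k k' h) hDr.le
  have hpq : ∀ k, k ≤ 2 * d → 1 - (p : ℝ) ≤ qv k ^ k := fun k hk => hQpow k hk
  have hlam0 : 0 ≤ lam := div_nonneg (Nat.cast_nonneg _) hlamDr.le
  have hlam1 : lam < 1 := (div_lt_one hlamDr).2 (by exact_mod_cast hlam)
  -- the semantic table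
  let R : Fin N → MState d := fun i => toM (stOf t i)
  let V : Fin N → ℝ := fun i => (vOf t i : ℝ)
  let sc : Fin N → Fin d × Bool → Option (Fin N × SPerm d) := fun i a =>
    match scOf t i (letterIdx a) with
    | none => none
    | some jc => if h : jc.1 < N then some ((⟨jc.1, h⟩ : Fin N), sym jc.2) else none
  have hrow : ∀ i : Fin N, ∃ v, t.find i = some v ∧ WF d v.2.1 = true ∧ AOK v.2.1 = true ∧ 1 ≤ v.1 ∧
      (∀ a, termOK τ d N syms t v.2.1 a (v.2.2.getD (letterIdx a) none) = true) ∧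
      lamD * rowValF τ kt d pn D QL t v.2.1 (fun k => v.2.2.getD k none) ≤ lamN * 2 * D ^ (8 * d + 1) * v.1 :=
    fun i => checkRowF_spec (hrows i i.2)
  have hst : ∀ (i : Fin N) v, t.find i = some v → stOf t i = v.2.1 := fun i v h => by simp [stOf, h]
  have hv : ∀ (i : Fin N) v, t.find i = some v → vOf t i = v.1 := fun i v h => by simp [vOf, h]
  have hsc : ∀ (i : Fin N) v, t.find i = some v → ∀ k, scOf t i k = v.2.2.getD k none := fun i v h k => by
    simp [scOf, h]
  have hV : ∀ i, 1 ≤ V i := fun i => by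
    obtain ⟨v, hf, -, -, hv1, -⟩ := hrow i
    show (1 : ℝ) ≤ (vOf t i : ℝ)
    rw [hv i v hf]; exact_mod_cast hv1
  have h0' : R ⟨0, hN⟩ = ∅ := by
    show toM (stOf t 0) = (∅ : MState d)
    rw [h0]; rfl
  -- simulation (weight-independent)
  have hsim : ∀ i a, simRel R (nstep τ (R i) a) (sc i a) = true := by
    intro i a
    obtain ⟨v, hf, hwf, -, -, hok, -⟩ := hrow i
    have hRi : R i = toM v.2.1 := by show toM (stOf t i) = _; rw [hst i v hf]
    have hoka := hok a
    unfold termOK at hoka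
    have hsci : sc i a = (match v.2.2.getD (letterIdx a) none with
        | none => none
        | some jc => if h : jc.1 < N then some ((⟨jc.1, h⟩ : Fin N), sym jc.2) else none) := by
      show (match scOf t i (letterIdx a) with
        | none => none
        | some jc => if h : jc.1 < N then some ((⟨jc.1, h⟩ : Fin N), sym jc.2) else none) = _
      rw [hsc i v hf]
    rw [hRi, nstep_toM hwf, hsci]
    cases hT : nstepK τ d v.2.1 a with
    | none =>
      rw [hT] at hoka
      cases hos : v.2.2.getD (letterIdx a) none with
      | none => rfl
      | some jc => rw [hos] at hoka; exact Bool.noConfusion hoka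
    | some T =>
      rw [hT] at hoka
      cases hos : v.2.2.getD (letterIdx a) none with
      | none => rw [hos] at hoka; exact Bool.noConfusion hoka
      | some jc =>
        rw [hos] at hoka
        rcases jc with ⟨j, c⟩
        simp only [Bool.and_eq_true, decide_eq_true_eq] at hoka
        obtain ⟨⟨hjN, hc⟩, hseq⟩ := hoka
        simp only [Option.map_some, dif_pos hjN, simRel, decide_eq_true_eq]
        rw [toM_eq_of_seteqK hseq, hsyms c hc, toM_actK]
  -- Collatz–Wielandt rows
  have hcw : ∀ i, (∑ a : Fin d × Bool, match sc i a with
      | none => 0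
      | some jg => (p : ℝ) * fwt τ kt qv (R i) a * V jg.1) ≤ lam * V i := by
    intro i
    obtain ⟨v, hf, hwf, hA, hv1, hok, hineq⟩ := hrow i
    have hRi : R i = toM v.2.1 := by show toM (stOf t i) = _; rw [hst i v hf]
    have hterm : ∀ a, (match sc i a with
        | none => 0
        | some jg => (p : ℝ) * fwt τ kt qv (R i) a * V jg.1) ≤
        (termValF τ kt d pn D QL t v.2.1 a (v.2.2.getD (letterIdx a) none) : ℝ) / (2 * (D : ℝ) ^ (8 * d + 1)) := by
      intro a
      have hoka := hok a
      unfold termOK at hoka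
      have hsci : sc i a = (match v.2.2.getD (letterIdx a) none with
          | none => none
          | some jc => if h : jc.1 < N then some ((⟨jc.1, h⟩ : Fin N), sym jc.2) else none) := by
        show (match scOf t i (letterIdx a) with
          | none => none
          | some jc => if h : jc.1 < N then some ((⟨jc.1, h⟩ : Fin N), sym jc.2) else none) = _
        rw [hsc i v hf]
      rw [hsci]
      cases hos : v.2.2.getD (letterIdx a) none with
      | none => simp only [termValF, Nat.cast_zero, zero_div, le_refl]
      | some jc =>
        rw [hos] at hoka
        cases hT : nstepK τ d v.2.1 a with
        | none => rw [hT] at hoka; exact Bool.noConfusion hoka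
        | some T =>
          rw [hT] at hoka
          rcases jc with ⟨j, c⟩
          simp only [Bool.and_eq_true, decide_eq_true_eq] at hoka
          obtain ⟨⟨hjN, -⟩, -⟩ := hoka
          simp only [dif_pos hjN, termValF]
          rw [termValF_real_eq hDr, uNumK_real_eq hDr hwf hA a]
          have hVj : V ⟨j, hjN⟩ = (vOf t j : ℝ) := rfl
          rw [hVj, hRi, fwt, hasCK_eq hwf hA a]
          set FN : ℕ := if fhasC τ kt (toM v.2.1 : MState d) a then D ^ (4 * d) + cNumK τ kt d D QL (fKK d v.2.1 a)
            else 2 * D ^ (4 * d) with hFN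
          have hF : (if fhasC τ kt (toM v.2.1 : MState d) a then (1 + fC τ kt qv (toM v.2.1 : MState d) a) / 2 else (1 : ℝ)) =
              (FN : ℝ) / (2 * (D : ℝ) ^ (4 * d)) := by
            have hD4 : (0 : ℝ) < (D : ℝ) ^ (4 * d) := pow_pos hDr _
            by_cases h0 : fhasC τ kt (toM v.2.1 : MState d) a = true
            · rw [if_pos h0, hFN, if_pos h0, hqv, ← cNumK_real_eq hDr hwf hA a]
              push_cast
              field_simp
            · rw [if_neg h0, hFN, if_neg h0]
              push_cast
              field_simp
          rw [hF]
          have hpv : (p : ℝ) = (pn : ℝ) / D := rfl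
          rw [hpv]
          apply le_of_eq
          ring
    calc (∑ a : Fin d × Bool, match sc i a with
            | none => 0
            | some jg => (p : ℝ) * fwt τ kt qv (R i) a * V jg.1)
        ≤ ∑ a : Fin d × Bool, (termValF τ kt d pn D QL t v.2.1 a (v.2.2.getD (letterIdx a) none) : ℝ) /
            (2 * (D : ℝ) ^ (8 * d + 1)) := Finset.sum_le_sum fun a _ => hterm a
      _ = (rowValF τ kt d pn D QL t v.2.1 (fun k => v.2.2.getD k none) : ℝ) / (2 * (D : ℝ) ^ (8 * d + 1)) := by
          rw [← Finset.sum_div, rowValF, ← sum_letters_eq, Nat.cast_list_sum, List.map_map]; rfl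
      _ ≤ lam * V i := by
          rw [div_le_iff₀ (by positivity), hlamdef]
          show _ ≤ (lamN : ℝ) / lamD * (vOf t i : ℝ) * (2 * (D : ℝ) ^ (8 * d + 1))
          rw [hv i v hf, div_mul_eq_mul_div, div_mul_eq_mul_div, le_div_iff₀ hlamDr]
          calc (rowValF τ kt d pn D QL t v.2.1 (fun k => v.2.2.getD k none) : ℝ) * lamD
              = ((lamD * rowValF τ kt d pn D QL t v.2.1 (fun k => v.2.2.getD k none) : ℕ) : ℝ) := by push_cast; ring
            _ ≤ ((lamN * 2 * D ^ (8 * d + 1) * v.1 : ℕ) : ℝ) := by exact_mod_cast hineq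
            _ = (lamN : ℝ) * (v.1 : ℝ) * (2 * (D : ℝ) ^ (8 * d + 1)) := by push_cast; ring
  exact le_siteCriticalProb_zd_of_freeMemTable (d := d) hτ hkt hkt2 p hq0 hq1 hmono hpq hlam0 hlam1
    R sc V ⟨0, hN⟩ h0' hV hsim hcw

end SoundF

end NawK

end Summit.CriticalPhenomena.PercolationContinuityZ3.Theorems.Pcint
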